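import Literature.Computability.Complexity.ListFoldChecks
import Literature.Computability.Complexity.ListBricks
import HarnessLib

/-!
# The noisy-IQP simulating machine, I: tuples of positions (the low-degree subsets) in the `FP` algebra

Support file for the discharge of `bremnerMontanaroShepherd2017_thm4`
(`Literature/Barriers/QuantumAdvantage/UncorrectedNoise.lean`): the classical sampler of
Bremner–Montanaro–Shepherd 2017, §3.1–3.2 stores one Fourier coefficient per subset `S ⊆ [N]`
with `|S| ≤ ℓ` (`n^{O(ℓ)}` of them). The machine (written, as everywhere in this library, in the
algebra of `FP` string functions of `BrickAlgebra.lean`/`FoldBricks.lean`/`ListFoldBricks.lean`, no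
Turing machine being programmed by hand) enumerates these subsets as **canonical tuples**: the
base-`(N+1)` digits `p₁, …, p_ℓ ∈ {0, …, N}` of a counter `c < (N+1)^ℓ`, accepted iff consecutive
digits satisfy `pᵢ < pᵢ₊₁ ∨ pᵢ₊₁ = N` (the sorted elements of `S`, padded with the blank `N`).
This file provides the tuple layer, every function total on all strings with its value on
well-formed arguments:

* `baseDigits K ℓ c`, `tupleCode l = encList (l.map ones)` (a tuple of unary numerals);
* `digitsFn ℓ ⟨1^K, 1^c⟩ = tupleCode (baseDigits K ℓ c)` (`ℓ`-fold `Plumb.divModFn`);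
* `canonFn ⟨1^N, tupleCode l⟩ = [IsCanon N l]` (the chain test `Brick.chainFn` of
  `ListFoldChecks.lean` with the consecutive-pair test `[p < q ∨ q = N]`);
* `sizeFn ⟨1^N, tupleCode l⟩ = 1^{#{p ∈ l | p ≠ N}}` (`|S|`), `markedCountFn ⟨y, tupleCode l⟩ =
  1^{#{p ∈ l | y[p] = 1}}` (so `χ_S(y) = (−1)^{…}`), `memTupleFn ⟨u, tupleCode l⟩ = [u ∈ l]`
  (`s_i`), `belowOrBlankFn ⟨⟨1^K, 1^N⟩, tupleCode l⟩ = [∀ p ∈ l, p < K ∨ p = N]` (`S ⊆ [K]`);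
* all of them are in `FP` (`*_mem_FP`).

## References

* [BremnerMontanaroShepherd2017] M. J. Bremner, A. Montanaro, D. J. Shepherd, *Achieving quantum
  supremacy with sparse and noisy commuting quantum computations*, Quantum 1 (2017) 8, §3.1
  ("This corresponds to approximating `n^{O(log(α/δ)/ε)}` Fourier coefficients").
* S. Arora, B. Barak, *Computational Complexity: A Modern Approach*, CUP 2009, §1.3 (closure of
  polynomial time under composition and bounded loops).
-/

namespace Literature.Barriers.QuantumAdvantage.NoisyIQPMachine

open _root_.Computability Literature.Computability.Complexity Literature.Computability.Complexity.Brick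
  Literature.Computability.Complexity.Plumb

/-! ### Base-`K` digits and tuple codes -/

/-- The `ℓ` least significant base-`K` digits of `c` (least significant first).
[folklore] -/
def baseDigits (K : ℕ) : ℕ → ℕ → List ℕ
  | 0, _ => []
  | ℓ + 1, c => c % K :: baseDigits K ℓ (c / K)

/-- There are `ℓ` digits. [folklore] -/
@[simp] theorem length_baseDigits (K : ℕ) : ∀ (ℓ c : ℕ), (baseDigits K ℓ c).length = ℓ
  | 0, _ => rfl
  | ℓ + 1, c => by simp [baseDigits, length_baseDigits K ℓ]

/-- Digits are below the base. [folklore] -/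
theorem lt_of_mem_baseDigits {K : ℕ} (hK : 0 < K) : ∀ {ℓ c p : ℕ}, p ∈ baseDigits K ℓ c → p < K
  | 0, _, _, h => by simp [baseDigits] at h
  | ℓ + 1, c, p, h => by
    simp only [baseDigits, List.mem_cons] at h
    rcases h with rfl | h
    · exact Nat.mod_lt _ hK
    · exact lt_of_mem_baseDigits hK h

/-- The code of a tuple of naturals: the coded list (`encList`) of their unary numerals.
[folklore] -/
def tupleCode (l : List ℕ) : List Bool := encList (l.map ones)

/-- `tupleCode [] = ε`. [folklore] -/
@[simp] theorem tupleCode_nil : tupleCode [] = [] := rfl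

/-- `tupleCode (p :: l) = ⟨1^p, tupleCode l⟩`. [folklore] -/
@[simp] theorem tupleCode_cons (p : ℕ) (l : List ℕ) : tupleCode (p :: l) = boolPair (ones p) (tupleCode l) := rfl

/-- Decoding a tuple code gives the unary numerals. [folklore] -/
@[simp] theorem decNil_tupleCode (l : List ℕ) : decNil (tupleCode l) = l.map ones := by
  rw [tupleCode, decNil_encList]

/-- **Digit extraction** `digitsFn ℓ ⟨1^K, 1^c⟩ = tupleCode (baseDigits K ℓ c)`: `ℓ` unary
divisions with remainder (`Plumb.divModFn`). [folklore] -/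
noncomputable def digitsFn : ℕ → List Bool → List Bool
  | 0 => fun _ => []
  | ℓ + 1 => fanoutFn (sndF ∘ divModFn) (digitsFn ℓ ∘ fanoutFn fstF (fstF ∘ divModFn))

/-- `digitsFn ℓ ∈ FP`. [cite: AroraBarak2009, §1.3] -/
theorem digitsFn_mem_FP : ∀ ℓ : ℕ, digitsFn ℓ ∈ FP
  | 0 => const_mem_FP _
  | ℓ + 1 => fanoutFn_mem_FP (comp_mem_FP sndF_mem_FP divModFn_mem_FP)
      (comp_mem_FP (digitsFn_mem_FP ℓ) (fanoutFn_mem_FP fstF_mem_FP (comp_mem_FP fstF_mem_FP divModFn_mem_FP)))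

/-- **Value of `digitsFn`.** [folklore] -/
theorem digitsFn_apply (K : ℕ) : ∀ (ℓ c : ℕ), digitsFn ℓ (boolPair (ones K) (ones c)) = tupleCode (baseDigits K ℓ c)
  | 0, c => rfl
  | ℓ + 1, c => by
    rw [digitsFn, fanoutFn_apply]
    simp only [Function.comp_apply, fanoutFn_apply, fstF_boolPair, divModFn_boolPair, sndF_boolPair]
    rw [digitsFn_apply K ℓ (c / K)]
    rfl

/-! ### Canonical tuples -/

/-- The local condition between consecutive entries of a canonical tuple: strictly increasing,
or the successor is the blank `N`. [folklore] -/
def CanonRel (N : ℕ) (p q : ℕ) : Prop := p < q ∨ q = N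

/-- `CanonRel` is decidable. [folklore] -/
instance CanonRel.decidable (N p q : ℕ) : Decidable (CanonRel N p q) := by unfold CanonRel; infer_instance

/-- A canonical tuple: consecutive entries are related by `CanonRel N` (for tuples with entries
`≤ N`, as the digits `baseDigits (N+1)` are — `lt_of_mem_baseDigits` — these are exactly the sorted
elements of a set of positions `< N`, padded with blanks `N`; the predicate itself does not bound
the entries). [folklore] -/
def IsCanon (N : ℕ) (l : List ℕ) : Prop := List.IsChain (CanonRel N) l

/-- `IsCanon` is decidable. [folklore] -/
instance IsCanon.decidable (N : ℕ) (l : List ℕ) : Decidable (IsCanon N l) := by unfold IsCanon; infer_instance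

/-- Unary numerals compare as the numbers: `eqPairFn ⟨1^p, 1^q⟩ = [p = q]` (twin of
`…QuantumComplexity.BosonFP.eqPairFn_ones` of `QuantumComplexity/BosonReductionMachine.lean`, not
in this file's import closure). [folklore] -/
theorem eqPairFn_ones (p q : ℕ) : eqPairFn (boolPair (ones p) (ones q)) = [decide (p = q)] := by
  rw [eqPairFn_boolPair]
  congr 1
  rw [decide_eq_decide]
  exact List.replicate_left_inj

/-- The one-bit consecutive-pair test `[p < q ∨ q = N]` on `⟨1^N, ⟨1^p, 1^q⟩⟩`. [folklore] -/
noncomputable def pairRelTest : List Bool → List Bool :=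
  orFn (ltLenF ∘ fanoutFn (fstF ∘ sndF) (sndF ∘ sndF)) (eqPairFn ∘ fanoutFn (sndF ∘ sndF) fstF)

/-- `pairRelTest` is one-bit. [folklore] -/
theorem oneBit_pairRelTest : OneBit pairRelTest :=
  oneBit_orFn (oneBit_ltLenF.comp _) (oneBit_eqPairFn.comp _)

/-- `pairRelTest ∈ FP`. [cite: AroraBarak2009, §1.3] -/
theorem pairRelTest_mem_FP : pairRelTest ∈ FP :=
  orFn_mem_FP (comp_mem_FP ltLenF_mem_FP (fanoutFn_mem_FP (comp_mem_FP fstF_mem_FP sndF_mem_FP)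
    (comp_mem_FP sndF_mem_FP sndF_mem_FP)))
    (comp_mem_FP eqPairFn_mem_FP (fanoutFn_mem_FP (comp_mem_FP sndF_mem_FP sndF_mem_FP) fstF_mem_FP))

/-- Value of `pairRelTest`. [folklore] -/
theorem pairRelTest_apply (N p q : ℕ) :
    pairRelTest (boolPair (ones N) (boolPair (ones p) (ones q))) = [decide (CanonRel N p q)] := by
  unfold pairRelTest CanonRel
  rw [orFn_apply (b := decide (p < q)) (b' := decide (q = N))]
  · cases hp : decide (p < q) <;> cases hq : decide (q = N) <;> simp_all
  · simp [ones]
  · simp only [Function.comp_apply, fanoutFn_apply, fstF_boolPair, sndF_boolPair]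
    exact eqPairFn_ones q N

/-- **The canonicity test** `canonFn ⟨1^N, tupleCode l⟩ = [IsCanon N l]`: the chain test of
`ListFoldChecks.lean` over the tuple. [folklore] -/
noncomputable def canonFn : List Bool → List Bool := chainFn pairRelTest

/-- `canonFn ∈ FP`. [cite: AroraBarak2009, §1.3] -/
theorem canonFn_mem_FP : canonFn ∈ FP := chainFn_mem_FP pairRelTest_mem_FP oneBit_pairRelTest

/-- `canonFn` is one-bit. [folklore] -/
theorem oneBit_canonFn : OneBit canonFn := oneBit_chainFn _

/-- **Value of `canonFn`.** [folklore] -/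
theorem canonFn_apply (N : ℕ) (l : List ℕ) : canonFn (boolPair (ones N) (tupleCode l)) = [decide (IsCanon N l)] := by
  have hiff : canonFn (boolPair (ones N) (tupleCode l)) = [true] ↔ IsCanon N l := by
    rw [canonFn, tupleCode, chainFn_encList_eq_true oneBit_pairRelTest, IsCanon, List.isChain_map]
    refine List.IsChain.iff fun p q => ?_
    rw [pairRelTest_apply]
    simp
  obtain ⟨b, hb⟩ := oneBit_canonFn (boolPair (ones N) (tupleCode l))
  rw [hb] at hiff ⊢
  cases b
  · have : ¬ IsCanon N l := fun h => by simpa using hiff.2 h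
    rw [decide_eq_false this]
  · rw [decide_eq_true (hiff.1 rfl)]

/-! ### Folds over a tuple: size, marked entries, membership, range test -/

/-- Fold step counting the entries different from the blank `1^N` (context `⟨1^N, T⟩`).
[folklore] -/
noncomputable def sizeStep : List Bool → List Bool :=
  iteFn (eqPairFn ∘ fanoutFn (fstF ∘ sndF) (fstF ∘ fstF)) (sndF ∘ sndF) (List.cons true ∘ sndF ∘ sndF)

/-- **`sizeFn ⟨1^N, tupleCode l⟩ = 1^{#{p ∈ l | p ≠ N}}`** (the size `|S|` of the coded subset).
[folklore] -/
noncomputable def sizeFn : List Bool → List Bool := foldFn sizeStep (fun _ => [])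

/-- Growth of `sizeStep`: at most one symbol per round. [folklore] -/
theorem foldGrowth_sizeStep : FoldGrowth 1 sizeStep := fun v => by
  unfold sizeStep
  rw [iteFn_of_oneBit (oneBit_eqPairFn.comp _)]
  split_ifs <;> simp <;> omega

/-- `sizeFn ∈ FP`. [cite: AroraBarak2009, §1.3] -/
theorem sizeFn_mem_FP : sizeFn ∈ FP :=
  foldFn_mem_FP (iteFn_mem_FP (comp_mem_FP eqPairFn_mem_FP (fanoutFn_mem_FP (comp_mem_FP fstF_mem_FP sndF_mem_FP)
    (comp_mem_FP fstF_mem_FP fstF_mem_FP))) (comp_mem_FP sndF_mem_FP sndF_mem_FP)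
    (comp_mem_FP (cons_mem_FP true) (comp_mem_FP sndF_mem_FP sndF_mem_FP))) (const_mem_FP _) foldGrowth_sizeStep

/-- The size fold, as a `foldl`. [folklore] -/
theorem foldl_sizeStep (N : ℕ) (w : List Bool) (hw : fstF w = ones N) : ∀ (l : List ℕ) (k : ℕ),
    (l.map ones).foldl (fun acc a => sizeStep (boolPair w (boolPair a acc))) (ones k) =
      ones (k + l.countP fun p => p ≠ N)
  | [], k => by simp
  | p :: l, k => by
    rw [List.map_cons, List.foldl_cons, List.countP_cons]
    have hstep : sizeStep (boolPair w (boolPair (ones p) (ones k))) = ones (k + if p ≠ N then 1 else 0) := by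
      unfold sizeStep
      rw [iteFn_apply (b := decide (p = N)) (by
        simp only [Function.comp_apply, fanoutFn_apply, fstF_boolPair, sndF_boolPair, hw]; exact eqPairFn_ones p N)]
      by_cases h : p = N
      · simp [h]
      · simp [h, ones, List.replicate_succ]
    rw [hstep, foldl_sizeStep N w hw l]
    congr 1
    simp only [decide_eq_true_eq]
    split_ifs <;> omega

/-- **Value of `sizeFn`.** [folklore] -/
theorem sizeFn_apply (N : ℕ) (l : List ℕ) :
    sizeFn (boolPair (ones N) (tupleCode l)) = ones (l.countP fun p => p ≠ N) := by
  rw [sizeFn, foldFn_boolPair, decNil_tupleCode]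
  have := foldl_sizeStep N (boolPair (ones N) (tupleCode l)) (fstF_boolPair _ _) l 0
  simpa using this

/-- Fold step counting the entries `p` with `y[p] = 1` (context `⟨y, T⟩`; positions beyond `|y|`
do not count). [folklore] -/
noncomputable def markStep : List Bool → List Bool :=
  iteFn (eqPairFn ∘ fanoutFn (bitAtFn ∘ fanoutFn (fstF ∘ sndF) (fstF ∘ fstF)) (fun _ => [true]))
    (List.cons true ∘ sndF ∘ sndF) (sndF ∘ sndF)

/-- **`markedCountFn ⟨y, tupleCode l⟩ = 1^{#{p ∈ l | y[p] = 1}}`** (so that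
`χ_S(y) = (−1)^{#…}` for the subset `S` coded by a canonical tuple). [folklore] -/
noncomputable def markedCountFn : List Bool → List Bool := foldFn markStep (fun _ => [])

/-- Growth of `markStep`. [folklore] -/
theorem foldGrowth_markStep : FoldGrowth 1 markStep := fun v => by
  unfold markStep
  rw [iteFn_of_oneBit (oneBit_eqPairFn.comp _)]
  split_ifs <;> simp <;> omega

/-- `markedCountFn ∈ FP`. [cite: AroraBarak2009, §1.3] -/
theorem markedCountFn_mem_FP : markedCountFn ∈ FP :=
  foldFn_mem_FP (iteFn_mem_FP (comp_mem_FP eqPairFn_mem_FP (fanoutFn_mem_FP (comp_mem_FP bitAtFn_mem_FP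
    (fanoutFn_mem_FP (comp_mem_FP fstF_mem_FP sndF_mem_FP) (comp_mem_FP fstF_mem_FP fstF_mem_FP))) (const_mem_FP _)))
    (comp_mem_FP (cons_mem_FP true) (comp_mem_FP sndF_mem_FP sndF_mem_FP)) (comp_mem_FP sndF_mem_FP sndF_mem_FP))
    (const_mem_FP _) foldGrowth_markStep

/-- Reading a bit at a unary position: `bitAtFn ⟨1^p, y⟩ = [true] ↔ y[p] = 1`. [folklore] -/
theorem bitAtFn_ones_eq_true_iff (p : ℕ) (y : List Bool) :
    bitAtFn (boolPair (ones p) y) = [true] ↔ y.getD p false = true := by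
  rw [bitAtFn_boolPair, List.length_replicate, List.getD_eq_getElem?_getD]
  rcases lt_or_ge p y.length with h | h
  · rw [List.take_one_drop_eq_of_lt_length h, List.getElem?_eq_getElem h]; simp
  · rw [List.drop_eq_nil_of_le h, List.getElem?_eq_none h]; simp

/-- The marked-count fold, as a `foldl`. [folklore] -/
theorem foldl_markStep (y w : List Bool) (hw : fstF w = y) : ∀ (l : List ℕ) (k : ℕ),
    (l.map ones).foldl (fun acc a => markStep (boolPair w (boolPair a acc))) (ones k) =
      ones (k + l.countP fun p => y.getD p false = true)
  | [], k => by simp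
  | p :: l, k => by
    rw [List.map_cons, List.foldl_cons, List.countP_cons]
    have hstep : markStep (boolPair w (boolPair (ones p) (ones k))) =
        ones (k + if y.getD p false = true then 1 else 0) := by
      unfold markStep
      rw [iteFn_apply (b := decide (bitAtFn (boolPair (ones p) y) = [true])) (by
        simp only [Function.comp_apply, fanoutFn_apply, fstF_boolPair, sndF_boolPair, hw, eqPairFn_boolPair])]
      by_cases h : y.getD p false = true
      · rw [show decide (bitAtFn (boolPair (ones p) y) = [true]) = true from
          decide_eq_true ((bitAtFn_ones_eq_true_iff p y).2 h), if_pos rfl, if_pos h]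
        simp [ones, List.replicate_succ]
      · rw [show decide (bitAtFn (boolPair (ones p) y) = [true]) = false from
          decide_eq_false (fun h' => h ((bitAtFn_ones_eq_true_iff p y).1 h')), if_neg h]
        simp
    rw [hstep, foldl_markStep y w hw l]
    congr 1
    simp only [decide_eq_true_eq]
    split_ifs <;> omega

/-- **Value of `markedCountFn`.** [folklore] -/
theorem markedCountFn_apply (y : List Bool) (l : List ℕ) :
    markedCountFn (boolPair y (tupleCode l)) = ones (l.countP fun p => y.getD p false = true) := by
  rw [markedCountFn, foldFn_boolPair, decNil_tupleCode]
  have := foldl_markStep y (boolPair y (tupleCode l)) (fstF_boolPair _ _) l 0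
  simpa using this

/-- **Membership** `memTupleFn ⟨u, tupleCode l⟩ = [u ∈ l.map ones]` (for `u = 1^i`: `[i ∈ l]`,
the bit `s_i` of the coded subset). [folklore] -/
noncomputable def memTupleFn : List Bool → List Bool := anyFn eqPairFn

/-- `memTupleFn ∈ FP`. [cite: AroraBarak2009, §1.3] -/
theorem memTupleFn_mem_FP : memTupleFn ∈ FP := anyFn_mem_FP eqPairFn_mem_FP oneBit_eqPairFn

/-- `memTupleFn` is one-bit. [folklore] -/
theorem oneBit_memTupleFn : OneBit memTupleFn := oneBit_anyFn oneBit_eqPairFn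

/-- **Value of `memTupleFn`** at a unary numeral. [folklore] -/
theorem memTupleFn_apply (i : ℕ) (l : List ℕ) :
    memTupleFn (boolPair (ones i) (tupleCode l)) = [decide (i ∈ l)] := by
  rw [memTupleFn, anyFn_boolPair oneBit_eqPairFn, decNil_tupleCode]
  congr 1
  rw [decide_eq_decide]
  constructor
  · rintro ⟨a, ha, h⟩
    obtain ⟨q, hq, rfl⟩ := List.mem_map.1 ha
    rw [eqPairFn_boolPair] at h
    have : ones i = ones q := by simpa using h
    rwa [List.replicate_left_inj.1 this]
  · intro hi
    exact ⟨ones i, List.mem_map.2 ⟨i, hi, rfl⟩, by rw [eqPairFn_boolPair]; simp⟩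

/-- The one-bit item test `[p < K ∨ p = N]` on `⟨⟨1^K, 1^N⟩, 1^p⟩`. [folklore] -/
noncomputable def belowOrBlankTest : List Bool → List Bool :=
  orFn (ltLenF ∘ fanoutFn sndF (fstF ∘ fstF)) (eqPairFn ∘ fanoutFn sndF (sndF ∘ fstF))

/-- `belowOrBlankTest` is one-bit. [folklore] -/
theorem oneBit_belowOrBlankTest : OneBit belowOrBlankTest :=
  oneBit_orFn (oneBit_ltLenF.comp _) (oneBit_eqPairFn.comp _)

/-- `belowOrBlankTest ∈ FP`. [cite: AroraBarak2009, §1.3] -/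
theorem belowOrBlankTest_mem_FP : belowOrBlankTest ∈ FP :=
  orFn_mem_FP (comp_mem_FP ltLenF_mem_FP (fanoutFn_mem_FP sndF_mem_FP (comp_mem_FP fstF_mem_FP fstF_mem_FP)))
    (comp_mem_FP eqPairFn_mem_FP (fanoutFn_mem_FP sndF_mem_FP (comp_mem_FP sndF_mem_FP fstF_mem_FP)))

/-- Value of `belowOrBlankTest`. [folklore] -/
theorem belowOrBlankTest_apply (K N p : ℕ) :
    belowOrBlankTest (boolPair (boolPair (ones K) (ones N)) (ones p)) = [decide (p < K ∨ p = N)] := by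
  unfold belowOrBlankTest
  rw [orFn_apply (b := decide (p < K)) (b' := decide (p = N))]
  · cases hp : decide (p < K) <;> cases hq : decide (p = N) <;> simp_all
  · simp [ones]
  · simp only [Function.comp_apply, fanoutFn_apply, fstF_boolPair, sndF_boolPair]
    exact eqPairFn_ones p N

/-- **Range test** `belowOrBlankFn ⟨⟨1^K, 1^N⟩, tupleCode l⟩ = [∀ p ∈ l, p < K ∨ p = N]` (the
coded subset lies inside `{0, …, K−1}`). [folklore] -/
noncomputable def belowOrBlankFn : List Bool → List Bool := allFn belowOrBlankTest

/-- `belowOrBlankFn ∈ FP`. [cite: AroraBarak2009, §1.3] -/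
theorem belowOrBlankFn_mem_FP : belowOrBlankFn ∈ FP := allFn_mem_FP belowOrBlankTest_mem_FP oneBit_belowOrBlankTest

/-- `belowOrBlankFn` is one-bit. [folklore] -/
theorem oneBit_belowOrBlankFn : OneBit belowOrBlankFn := oneBit_allFn oneBit_belowOrBlankTest

/-- **Value of `belowOrBlankFn`.** [folklore] -/
theorem belowOrBlankFn_apply (K N : ℕ) (l : List ℕ) :
    belowOrBlankFn (boolPair (boolPair (ones K) (ones N)) (tupleCode l)) = [decide (∀ p ∈ l, p < K ∨ p = N)] := by
  rw [belowOrBlankFn, allFn_boolPair oneBit_belowOrBlankTest, decNil_tupleCode]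
  congr 1
  rw [decide_eq_decide]
  constructor
  · intro h p hp
    have := h (ones p) (List.mem_map.2 ⟨p, hp, rfl⟩)
    rw [belowOrBlankTest_apply] at this
    simpa using this
  · intro h a ha
    obtain ⟨p, hp, rfl⟩ := List.mem_map.1 ha
    rw [belowOrBlankTest_apply]
    simpa using h p hp

end Literature.Barriers.QuantumAdvantage.NoisyIQPMachine
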